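import Summits.Ventures.CertifiedArithmetic.LowPrec.GemmThetaE2M1Fp16Defs

/-!
# The θ-certificate of E2M1²→binary16: kernel check of the states with index in `[3072, 4096)`

HONEST FRAMING (venture CertifiedArithmetic / cell `pub-lowprec`, seat gemm, gen 10): certified error
envelopes and provably optimal rounding/accumulation schemes for low-precision formats under stated
cost models; every table by two implementations; no hardware or vendor claims.

Part 4 of 9 of the kernel check of the Boolean certificate of `GemmThetaE2M1Fp16Defs.lean`
(paper `gemm.tex` §Regimes Prop. Θ(i), configuration E2M1·E2M1 → `binary16`, sequential, RNE,
saturating model): every edge from the states with index `3072 ≤ i < 4096` (both signs, all 37 letters,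
with the pair checks after free moves) passes `edgeOK`, by `decide +kernel` in chunks of 256 indices
(each chunk = 18,944 edges).  Split into files only to bound each file's kernel time;
`GemmThetaE2M1Fp16.lean` assembles the parts.  See the Defs file for the meaning of the check.
-/

namespace Literature.ComputerArithmetic.FloatingPoint

namespace MiniFloat

namespace ThetaE2M1Fp16

/-- Every edge from the states with index in `[3072, 3328)` (both signs, all 37 letters) passes
`edgeOK`. [cell certificate, kernel-checked] -/
theorem edges_ok_3072 : rowsOK 3072 256 = true := by
  decide +kernel

/-- Every edge from the states with index in `[3328, 3584)` (both signs, all 37 letters) passes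
`edgeOK`. [cell certificate, kernel-checked] -/
theorem edges_ok_3328 : rowsOK 3328 256 = true := by
  decide +kernel

/-- Every edge from the states with index in `[3584, 3840)` (both signs, all 37 letters) passes
`edgeOK`. [cell certificate, kernel-checked] -/
theorem edges_ok_3584 : rowsOK 3584 256 = true := by
  decide +kernel

/-- Every edge from the states with index in `[3840, 4096)` (both signs, all 37 letters) passes
`edgeOK`. [cell certificate, kernel-checked] -/
theorem edges_ok_3840 : rowsOK 3840 256 = true := by
  decide +kernel

/-- PART 4: every edge from the states with index in `[3072, 4096)` passes `edgeOK`.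
[cell certificate, kernel-checked] -/
theorem part_04 : rowsOK 3072 1024 = true :=
  rowsOK_append 3072 256 768 edges_ok_3072 <|
  rowsOK_append 3328 256 512 edges_ok_3328 <|
  rowsOK_append 3584 256 256 edges_ok_3584 <|
  edges_ok_3840

end ThetaE2M1Fp16

end MiniFloat

end Literature.ComputerArithmetic.FloatingPoint
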